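import Summits.HubbardSuperconductivity.HubbardSuperconductivity.Theorems.ThermalWedgeTwTipContinuationEdgeOrderBCSExpectations
import Literature.MathematicalPhysics.QuantumLattice.HubbardWave0RepulsiveProofs
import Literature.MathematicalPhysics.QuantumLattice.FinDimSpectrumSectorGibbsLimit
import Literature.MathematicalPhysics.QuantumLattice.TorusCooperSumFermiLevel
import Literature.MathematicalPhysics.QuantumLattice.TorusBandEdgeCounting
import Literature.MathematicalPhysics.QuantumLattice.DWaveSourceProofs
import Literature.MathematicalPhysics.QuantumLattice.HubbardFreeCovariance

/-!
# Route `WeakCouplingBCS`, support item `WcbcsSourcedFreeGasCooperLog`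
# (stmt-HubbardSuperconductivity-1210): the canonical free Fermi sea at the shell level

Two finite-`L` facts about the FREE (`U = 0`, hopping `1`) Hubbard torus `(ℤ/Lℤ)²` feeding the Cooper
logarithm of the sourced free gas:

* `free_sectorEnergy_sub_fermiLevel_mul_le` — **canonical/grand-canonical match at the shell level**:
  for `0 < m ≤ L²` and `μ_L = torusFermiLevel L (2m)` (the energy of the `m`-th lowest free level),
  `E₀^{(2m, S^z=0)}(hubbardTorus 2 L 1 0) - μ_L · 2m ≤ 2 Σ_k min(ε_L(k) - μ_L, 0)`: fill a set `S` of `m`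
  levels nested between `{ε_L < μ_L}` and `{ε_L ≤ μ_L}` (`exists_fermiSet`) with the plane-wave Slater
  determinant `Π_{k∈S} c†_{k↑}c†_{-k↓}|0⟩` (`exists_planeWaveSlater`, the BCS product state of
  `ThermalWedgeTwTipContinuationEdgeOrderProductState` with coefficients in `{0,1}`); levels equal to
  `μ_L` contribute `0`, so the shell degeneracy is harmless.
* `exists_fermiLevel_window` — **the shell level of the doped sea stays inside `(-4, 0)`**: for
  `δ ∈ (0,1)` there are `d₀ > 0`, `L₁` with `μ_L(N_L) ∈ [-4 + d₀, -d₀]`, `N_L = 2⌊(1-δ)L²/2⌋`, for all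
  `L ≥ L₁` (bottom: `torusFermiLevel_mem_Icc`; top: the lattice diamond `two_mul_sq_le_card_filter_torusBand_lt`
  holds `≥ (1-δ)L²/2` levels strictly below `-2cos²(πa)`, `a = 1/2 - δ/8`).

Sources: standard free-fermion bookkeeping (Lieb, PRL 62 (1989) 1201 §2 for sectors); no definition and
no named fact.
-/

noncomputable section

namespace Summit.HubbardSuperconductivity.HubbardSuperconductivity.Theorems

open Matrix Finset Real Literature.MathematicalPhysics.QuantumLattice Literature.Probability.LatticeModels
open Summit.HubbardSuperconductivity.TwTipContinuation.IsogapTransport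
open scoped ComplexOrder

section Slater

variable {L : ℕ} [NeZero L]

/-- **Plane-wave Slater determinants in the `(2|S|, S^z=0)` sector** (`L ≥ 3`): for a set `S` of torus
momenta the product vector `Π_{k∈S} c†_{k↑}c†_{-k↓} |0⟩` is a unit vector of `szSector (2|S|) 0` with free
kinetic energy `2 Σ_{k∈S} ε_L(k)`. (Same statement and proof as `exists_slater_trialState` of
`ThermalWedgeTwExponentialCeilingSlater`, re-derived here so that this module does not import another
route's Theses file.) [folklore] -/
theorem exists_planeWaveSlater (hL : 3 ≤ L) (S : Finset (TorusSite 2 L)) :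
    ∃ Ψ : Fock (Orb (FermionTorus 2 L)), star Ψ ⬝ᵥ Ψ = 1 ∧
      Ψ ∈ szSector (Λ := FermionTorus 2 L) (2 * S.card) (0 : ℝ) ∧
      (star Ψ ⬝ᵥ (hubbardTorus 2 L 1 0 *ᵥ Ψ)).re = 2 * ∑ k ∈ S, torusBand L k := by
  classical
  set u : TorusSite 2 L → ℝ := fun k => if k ∈ S then 0 else 1 with hu
  set v : TorusSite 2 L → ℝ := fun k => if k ∈ S then 1 else 0 with hv
  have huv : ∀ k, u k ^ 2 + v k ^ 2 = 1 := fun k => by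
    by_cases h : k ∈ S <;> simp [hu, hv, h]
  have hv2 : ∀ k, v k ^ 2 = if k ∈ S then 1 else 0 := fun k => by
    by_cases h : k ∈ S <;> simp [hv, h]
  set Ψ : Fock (Orb (FermionTorus 2 L)) :=
    (List.map (fun k => ((u k : ℝ) : ℂ) •
        (1 : Matrix (Finset (Orb (FermionTorus 2 L))) (Finset (Orb (FermionTorus 2 L))) ℂ) +
        ((v k : ℝ) : ℂ) • (pairMode k)ᴴ) (Finset.univ : Finset (TorusSite 2 L)).toList).prod *ᵥ
      (vacuum : Fock (Orb (FermionTorus 2 L))) with hΨ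
  have hnorm : star Ψ ⬝ᵥ Ψ = 1 := star_prodState_dotProduct_self u v huv (Finset.nodup_toList _)
  have hNbar : (∑ k : TorusSite 2 L, 2 * (v k) ^ 2 : ℝ) = 2 * S.card := by
    simp_rw [hv2]
    rw [← Finset.mul_sum, Finset.sum_boole]
    simp
  have hvar := variance_totalNumber_prodState u v huv
  have hvar0 : (∑ k : TorusSite 2 L, (4 * (v k) ^ 2 - 4 * (v k) ^ 4) : ℝ) = 0 := by
    refine Finset.sum_eq_zero fun k _ => ?_
    have : v k ^ 4 = (v k ^ 2) ^ 2 := by ring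
    rw [this, hv2]
    by_cases h : k ∈ S <;> simp [h]
  rw [hvar0, Complex.ofReal_zero, dotProduct_star_self_eq_zero, sub_eq_zero, hNbar] at hvar
  have hN : IsNParticle (2 * S.card) Ψ := by
    rw [LiebTwo.isNParticle_iff_totalNumber, hΨ]
    convert hvar using 2
    push_cast
    ring
  have hbal : Ψ ∈ spinBalanced := prodState_mem_spinBalanced u v _
  refine ⟨Ψ, hnorm, ?_, ?_⟩
  · rw [mem_szSector_iff]
    refine ⟨hN, ?_⟩
    rw [spinZ_mulVec_eq_zero_of_mem_spinBalanced hbal, Complex.ofReal_zero, zero_smul]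
  · rw [hubbardTorus_zero_eq_sum_momentumNumber hL, hΨ, expect_oneBody_prodState u v huv (torusBand L),
      Complex.ofReal_re]
    have hneg : ∑ k : TorusSite 2 L, torusBand L k * v (-k) ^ 2 =
        ∑ k : TorusSite 2 L, torusBand L k * v k ^ 2 := by
      rw [← Equiv.sum_comp (Equiv.neg (TorusSite 2 L)) (fun k => torusBand L k * v k ^ 2)]
      refine Finset.sum_congr rfl fun k _ => ?_
      simp only [Equiv.neg_apply, torusBand_neg]
    simp_rw [mul_add]
    rw [Finset.sum_add_distrib, hneg, ← two_mul]
    congr 1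
    simp_rw [hv2, mul_ite, mul_one, mul_zero]
    rw [Finset.sum_ite_mem, Finset.univ_inter]

/-- **Variational (Slater) upper bound on the free sector energy** (`L ≥ 3`):
`E₀^{(2|S|,0)}(hubbardTorus 2 L 1 0) ≤ 2 Σ_{k∈S} ε_L(k)` for every set `S` of momenta. [folklore] -/
theorem free_sectorEnergy_le_two_mul_sum (hL : 3 ≤ L) (S : Finset (TorusSite 2 L)) :
    (hubbardTorus 2 L 1 0).minEnergyOn (szSector (Λ := FermionTorus 2 L) (2 * S.card) (0 : ℝ)) ≤
      2 * ∑ k ∈ S, torusBand L k := by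
  obtain ⟨Ψ, h1, hsec, hkin⟩ := exists_planeWaveSlater hL S
  have hH : (hubbardTorus 2 L 1 0).IsHermitian := by
    rw [← hubbardTorusWith_zero]; exact isHermitian_hubbardTorusWith L 1 0 0
  rw [← hkin]
  exact minEnergyOn_le_rayleigh_of_mem hH _ hsec h1

/-- **A Fermi set at the shell level**: for `0 < m ≤ L²` and `μ_L = torusFermiLevel L (2m)` there is a
set `S` of exactly `m` momenta with `ε_L ≤ μ_L` on `S` and `ε_L ≥ μ_L` off `S` (fewer than `m` levels
lie strictly below the shell level and at least `m` lie weakly below it). [folklore] -/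
theorem exists_fermiSet {m : ℕ} (hm : 0 < m) (hmL : m ≤ L ^ 2) :
    ∃ S : Finset (TorusSite 2 L), S.card = m ∧
      (∀ k ∈ S, torusBand L k ≤ torusFermiLevel L (2 * m)) ∧
      (∀ k, k ∉ S → torusFermiLevel L (2 * m) ≤ torusBand L k) := by
  classical
  have hN : 0 < 2 * m := by omega
  have hNL : 2 * m ≤ 2 * L ^ 2 := by omega
  set μF := torusFermiLevel L (2 * m) with hμF
  set A : Finset (TorusSite 2 L) := univ.filter fun k => torusBand L k < μF with hA
  set B : Finset (TorusSite 2 L) := univ.filter fun k => torusBand L k ≤ μF with hB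
  have hAB : A ⊆ B := fun k hk => by
    rw [hA, mem_filter] at hk; rw [hB, mem_filter]; exact ⟨hk.1, hk.2.le⟩
  have hBcard : m ≤ B.card := by
    have h := le_two_mul_torusLevelCount_torusFermiLevel (L := L) hN hNL
    rw [torusLevelCount_def] at h
    change 2 * m ≤ 2 * B.card at h
    omega
  have hAcard : A.card ≤ m := by
    by_cases hAne : A.Nonempty
    · set E := A.sup' hAne (fun k => torusBand L k) with hE
      have hElt : E < μF := by
        obtain ⟨k₀, hk₀, hk₀E⟩ := exists_mem_eq_sup' hAne (fun k => torusBand L k)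
        rw [hE, hk₀E]
        exact (mem_filter.mp hk₀).2
      have hcount : torusLevelCount L E = A.card := by
        rw [torusLevelCount_def]
        congr 1
        ext k
        simp only [mem_filter, mem_univ, true_and, hA]
        exact ⟨fun hk => hk.trans_lt hElt, fun hk => le_sup' (fun k => torusBand L k) (mem_filter.mpr ⟨mem_univ k, hk⟩)⟩
      have h := two_mul_torusLevelCount_lt (L := L) hN hNL hElt
      rw [hcount] at h
      omega
    · rw [not_nonempty_iff_eq_empty.mp hAne, card_empty]; exact Nat.zero_le _
  obtain ⟨S, hAS, hSB, hScard⟩ := exists_subsuperset_card_eq hAB hAcard hBcard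
  refine ⟨S, hScard, fun k hk => (mem_filter.mp (hSB hk)).2, fun k hk => ?_⟩
  by_contra hlt
  push Not at hlt
  exact hk (hAS (mem_filter.mpr ⟨mem_univ k, hlt⟩))

/-- **Canonical/grand-canonical match at the shell level** (`L ≥ 3`, `0 < m ≤ L²`): with
`μ_L = torusFermiLevel L (2m)`,
`E₀^{(2m, S^z=0)}(hubbardTorus 2 L 1 0) - μ_L · (2m) ≤ 2 Σ_k min(ε_L(k) - μ_L, 0)` — the right-hand side
is the grand-canonical free ground energy `E₀(hubbardTorusWith 2 L 1 0 μ_L)`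
(`groundEnergy_hubbardTorusWith_zero`). [folklore] -/
theorem free_sectorEnergy_sub_fermiLevel_mul_le (hL : 3 ≤ L) {m : ℕ} (hm : 0 < m) (hmL : m ≤ L ^ 2) :
    (hubbardTorus 2 L 1 0).minEnergyOn (szSector (Λ := FermionTorus 2 L) (2 * m) (0 : ℝ)) -
        torusFermiLevel L (2 * m) * ((2 * m : ℕ) : ℝ) ≤
      2 * ∑ k : TorusSite 2 L, min (torusBand L k - torusFermiLevel L (2 * m)) 0 := by
  classical
  obtain ⟨S, hScard, hSle, hSge⟩ := exists_fermiSet (L := L) hm hmL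
  have hE := free_sectorEnergy_le_two_mul_sum hL S
  rw [hScard] at hE
  set μF := torusFermiLevel L (2 * m) with hμF
  have hsplit : ∑ k : TorusSite 2 L, min (torusBand L k - μF) 0 =
      ∑ k ∈ S, min (torusBand L k - μF) 0 + ∑ k ∈ Sᶜ, min (torusBand L k - μF) 0 :=
    (sum_add_sum_compl S _).symm
  have hS : ∑ k ∈ S, min (torusBand L k - μF) 0 = ∑ k ∈ S, torusBand L k - μF * m := by
    rw [Finset.sum_congr rfl fun k hk => min_eq_left (sub_nonpos.mpr (hSle k hk)), sum_sub_distrib,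
      sum_const, hScard, nsmul_eq_mul, mul_comm]
  have hSc : ∑ k ∈ Sᶜ, min (torusBand L k - μF) 0 = 0 :=
    Finset.sum_eq_zero fun k hk => min_eq_right (sub_nonneg.mpr (hSge k (mem_compl.mp hk)))
  rw [hsplit, hS, hSc, add_zero]
  push_cast
  linarith

end Slater

/-! ### The shell level of the doped Fermi sea stays inside `(-4, 0)` -/

section Window

variable {L : ℕ} [NeZero L]

omit [NeZero L] in
/-- Electron-number bookkeeping at doping `δ ∈ (0,1)`: for `L ≥ 4/(1-δ)`,
`0 < N_L`, `N_L ≤ 2L²`, `(1-δ)L²/2 ≤ N_L ≤ (1-δ)L²` with `N_L = 2⌊(1-δ)L²/2⌋`. [folklore] -/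
theorem electronNumber_bounds {δ : ℝ} (hδ0 : 0 < δ) (hδ1 : δ < 1) (hL : 4 / (1 - δ) ≤ (L : ℝ)) :
    0 < 2 * ⌊(1 - δ) * (L : ℝ) ^ 2 / 2⌋₊ ∧ 2 * ⌊(1 - δ) * (L : ℝ) ^ 2 / 2⌋₊ ≤ 2 * L ^ 2 ∧
      (1 - δ) / 2 * (L : ℝ) ^ 2 ≤ ((2 * ⌊(1 - δ) * (L : ℝ) ^ 2 / 2⌋₊ : ℕ) : ℝ) ∧
      ((2 * ⌊(1 - δ) * (L : ℝ) ^ 2 / 2⌋₊ : ℕ) : ℝ) ≤ (1 - δ) * (L : ℝ) ^ 2 := by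
  have hδ : 0 < 1 - δ := by linarith
  have hL1 : (1 : ℝ) ≤ L := by
    have : (4 : ℝ) ≤ 4 / (1 - δ) := by rw [le_div_iff₀ hδ]; nlinarith
    linarith
  have hLsq : 4 / (1 - δ) ≤ (L : ℝ) ^ 2 := hL.trans (by nlinarith)
  set x : ℝ := (1 - δ) * (L : ℝ) ^ 2 / 2 with hx
  have hx0 : 0 ≤ x := by positivity
  have hfl1 : (⌊x⌋₊ : ℝ) ≤ x := Nat.floor_le hx0
  have hfl2 : x < ⌊x⌋₊ + 1 := Nat.lt_floor_add_one x
  have hx4 : 2 ≤ x := by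
    rw [hx, le_div_iff₀ two_pos]
    rw [div_le_iff₀ hδ] at hLsq
    linarith
  have hfl_pos : 0 < ⌊x⌋₊ := by
    have : (0 : ℝ) < ⌊x⌋₊ := by linarith
    exact_mod_cast this
  have hxL : x ≤ (L : ℝ) ^ 2 / 2 := by
    rw [hx]; apply div_le_div_of_nonneg_right _ two_pos.le; nlinarith
  have hfl_le : ⌊x⌋₊ ≤ L ^ 2 := by
    have : (⌊x⌋₊ : ℝ) ≤ (L : ℝ) ^ 2 := by nlinarith
    exact_mod_cast this
  refine ⟨by omega, by omega, ?_, ?_⟩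
  · push_cast; linarith
  · push_cast; linarith

/-- **Top of the window**: for `δ ∈ (0,1)`, `a = 1/2 - δ/8` and `L ≥ 8/δ` (and `L ≥ 4/(1-δ)`), the
shell level of `N_L = 2⌊(1-δ)L²/2⌋` electrons satisfies `μ_L(N_L) ≤ -2cos²(πa) < 0`: the lattice
diamond of folded radius `M = ⌊aL⌋` already holds `2M² ≥ N_L/2` levels strictly below `-2cos²(πa)`.
[folklore] -/
theorem torusFermiLevel_doping_le {δ : ℝ} (hδ0 : 0 < δ) (hδ1 : δ < 1) (hL : 4 / (1 - δ) ≤ (L : ℝ))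
    (hL' : 8 / δ ≤ (L : ℝ)) :
    torusFermiLevel L (2 * ⌊(1 - δ) * (L : ℝ) ^ 2 / 2⌋₊) ≤ -(2 * Real.cos (π * (1 / 2 - δ / 8)) ^ 2) := by
  obtain ⟨hN0, hN2, _, hNhi⟩ := electronNumber_bounds (L := L) hδ0 hδ1 hL
  set N := 2 * ⌊(1 - δ) * (L : ℝ) ^ 2 / 2⌋₊ with hNdef
  set a : ℝ := 1 / 2 - δ / 8 with ha
  have hLpos : (0 : ℝ) < L := by
    have : (0 : ℝ) < 8 / δ := by positivity
    linarith
  have ha0 : 0 < a := by rw [ha]; linarith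
  have ha2 : a < 1 / 2 := by rw [ha]; linarith
  set M : ℕ := ⌊a * L⌋₊ with hM
  have hM1 : (M : ℝ) ≤ a * L := Nat.floor_le (by positivity)
  have hM2 : a * L - 1 < M := by
    have := Nat.lt_floor_add_one (a * L); rw [← hM] at this; linarith
  -- `2M < L`
  have h2M : 2 * M < L := by
    have : (2 * M : ℝ) < L := by nlinarith
    exact_mod_cast this
  -- `N ≤ 2 · 2M²`
  have hMN : (N : ℝ) ≤ 2 * (2 * (M : ℝ) ^ 2) := by
    -- `M ≥ aL - 1 ≥ (2-δ)L/4` since `(a - (2-δ)/4) L = δL/8 ≥ 1`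
    have hb : (2 - δ) / 4 * L ≤ M := by
      have : δ / 8 * L ≥ 1 := by
        rw [ge_iff_le, ← div_le_iff₀' (by positivity)]
        calc 1 / (δ / 8) = 8 / δ := by field_simp
          _ ≤ L := hL'
      rw [ha] at hM2
      nlinarith
    have hb0 : 0 ≤ (2 - δ) / 4 * L := by
      have : 0 ≤ 2 - δ := by linarith
      positivity
    have hMsq : ((2 - δ) / 4 * L) ^ 2 ≤ (M : ℝ) ^ 2 := pow_le_pow_left₀ hb0 hb 2
    have hkey : (1 - δ) * (L : ℝ) ^ 2 ≤ 4 * ((2 - δ) / 4 * L) ^ 2 := by nlinarith [sq_nonneg (δ * L)]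
    linarith
  have hMN' : N ≤ 2 * (2 * M ^ 2) := by
    have : (N : ℝ) ≤ ((2 * (2 * M ^ 2) : ℕ) : ℝ) := by push_cast; linarith
    exact_mod_cast this
  -- the diamond lies strictly below `-2cos²(πa)`
  have hcos_pos : 0 < Real.cos (π * a) := by
    apply Real.cos_pos_of_mem_Ioo
    constructor
    · nlinarith [Real.pi_pos]
    · nlinarith [Real.pi_pos]
  have hcosM : Real.cos (π * a) ≤ Real.cos (π * M / L) := by
    apply Real.cos_le_cos_of_nonneg_of_le_pi
    · positivity
    · nlinarith [Real.pi_pos]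
    · rw [mul_div_assoc]
      refine mul_le_mul_of_nonneg_left ?_ Real.pi_pos.le
      rw [div_le_iff₀ hLpos]
      exact hM1
  have hμ : -4 * Real.cos (π * M / L) ^ 2 < -(2 * Real.cos (π * a) ^ 2) := by
    have h1 : Real.cos (π * a) ^ 2 ≤ Real.cos (π * M / L) ^ 2 := pow_le_pow_left₀ hcos_pos.le hcosM 2
    have h2 : 0 < Real.cos (π * a) ^ 2 := by positivity
    nlinarith
  have hcount := two_mul_sq_le_card_filter_torusBand_lt (L := L) h2M hμ
  have hle : (univ.filter fun k : TorusSite 2 L => torusBand L k < -(2 * Real.cos (π * a) ^ 2)).card ≤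
      torusLevelCount L (-(2 * Real.cos (π * a) ^ 2)) := by
    rw [torusLevelCount_def]
    exact card_le_card fun k hk => by
      rw [mem_filter] at hk ⊢; exact ⟨hk.1, hk.2.le⟩
  have hmem : N ≤ 2 * torusLevelCount L (-(2 * Real.cos (π * a) ^ 2)) :=
    hMN'.trans (Nat.mul_le_mul_left 2 (hcount.trans hle))
  exact (torusFermiLevel_isLeast hN0 hN2).2 hmem

/-- **The shell level of the doped free Fermi sea lies in a fixed window inside `(-4, 0)`**: for every
`δ ∈ (0,1)` there are `d₀ > 0` and `L₁` such that for all `L ≥ L₁` the canonical Fermi level of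
`N_L = 2⌊(1-δ)L²/2⌋` free electrons on the `L × L` torus satisfies `-4 + d₀ ≤ μ_L(N_L) ≤ -d₀`
(and `0 < N_L ≤ 2L²`). [folklore] -/
theorem exists_fermiLevel_window {δ : ℝ} (hδ0 : 0 < δ) (hδ1 : δ < 1) :
    ∃ d₀ : ℝ, 0 < d₀ ∧ ∃ L₁ : ℕ, ∀ (L : ℕ) [NeZero L], L₁ ≤ L →
      0 < 2 * ⌊(1 - δ) * (L : ℝ) ^ 2 / 2⌋₊ ∧ 2 * ⌊(1 - δ) * (L : ℝ) ^ 2 / 2⌋₊ ≤ 2 * L ^ 2 ∧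
      d₀ ≤ torusFermiLevel L (2 * ⌊(1 - δ) * (L : ℝ) ^ 2 / 2⌋₊) + 4 ∧
      d₀ ≤ -torusFermiLevel L (2 * ⌊(1 - δ) * (L : ℝ) ^ 2 / 2⌋₊) := by
  set θ : ℝ := (1 - δ) / 2 with hθ
  have hθ0 : 0 < θ := by rw [hθ]; linarith
  set d₁ : ℝ := 2 * Real.cos (π * (1 / 2 - δ / 8)) ^ 2 with hd₁
  have hcos_pos : 0 < Real.cos (π * (1 / 2 - δ / 8)) := by
    apply Real.cos_pos_of_mem_Ioo
    constructor
    · nlinarith [Real.pi_pos]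
    · nlinarith [Real.pi_pos]
  have hd₁0 : 0 < d₁ := by positivity
  refine ⟨min (θ ^ 2 / 16) d₁, lt_min (by positivity) hd₁0,
    ⌈max (max (4 / (1 - δ)) (8 / δ)) (Real.sqrt (18 / θ))⌉₊, ?_⟩
  intro L _ hL
  have hL' : max (max (4 / (1 - δ)) (8 / δ)) (Real.sqrt (18 / θ)) ≤ (L : ℝ) := Nat.ceil_le.mp hL
  have hLa : 4 / (1 - δ) ≤ (L : ℝ) := ((le_max_left _ _).trans (le_max_left _ _)).trans hL'
  have hLb : 8 / δ ≤ (L : ℝ) := ((le_max_right _ _).trans (le_max_left _ _)).trans hL'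
  have hLc : Real.sqrt (18 / θ) ≤ (L : ℝ) := (le_max_right _ _).trans hL'
  obtain ⟨hN0, hN2, hNlo, hNhi⟩ := electronNumber_bounds (L := L) hδ0 hδ1 hLa
  have h18 : 18 ≤ θ * (L : ℝ) ^ 2 := by
    have h1 : 18 / θ ≤ (L : ℝ) ^ 2 := by
      calc 18 / θ = Real.sqrt (18 / θ) ^ 2 := by rw [Real.sq_sqrt (by positivity)]
        _ ≤ (L : ℝ) ^ 2 := pow_le_pow_left₀ (Real.sqrt_nonneg _) hLc 2
    rwa [div_le_iff₀' hθ0] at h1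
  have hlo := (torusFermiLevel_mem_Icc (L := L) hθ0 h18 (N := 2 * ⌊(1 - δ) * (L : ℝ) ^ 2 / 2⌋₊)
    (by rw [hθ]; exact hNlo) (by rw [hθ]; nlinarith)).1
  have hhi := torusFermiLevel_doping_le (L := L) hδ0 hδ1 hLa hLb
  refine ⟨hN0, hN2, ?_, ?_⟩
  · have := min_le_left (θ ^ 2 / 16) d₁; linarith
  · have := min_le_right (θ ^ 2 / 16) d₁; rw [← hd₁] at hhi; linarith

end Window

end Summit.HubbardSuperconductivity.HubbardSuperconductivity.Theorems

end
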